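import Mathlib.Order.Interval.Set.Pi
import Mathlib.Data.Real.Basic
import Mathlib.Data.Fin.VecNotation
import Mathlib.Tactic.Linarith
import Mathlib.Tactic.FinCases
import Mathlib.Tactic.Ring
import Literature.Computation.Certificates.BoxCoverCertificate
import HarnessLib

/-!
# Box-wide WIDTH and HULL certificates for a pool of multilinear two-sided words
# (kd-tree certificates whose leaves name a floor word and a cap word; corner checks)

Topic `Literature/Computation/Certificates` (third part of the box-covering story:
`BoxCoveringByCells.lean` = composition GIVEN a product-grid cover; `BoxCoverCertificate.lean` =
kernel-checked cover of a delivered box by an ARBITRARY finite union of cells, kd-tree certificates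
`KdCert` with the cell-containment leaf `cellLeaf`). Written for the Hubbard material oracle, stage S2
(D-0096/D-0097, D-0153 (1)): the certifier issues two-sided words on CELLS of the parameter space
`θ = (U/t, t'/t, n)`, each of the kernel shape
`∀ θ ∈ Set.Icc lo hi, F(θ) ≤ e(θ) ≤ C(θ)` with `F`, `C` MULTILINEAR (coordinatewise affine) forms with
rational coefficients (the tree's `…_word_Icc` (constant), `…_affword_Icc` (affine) and `…_mlword_Icc`
(8-monomial) shapes, thousands of them from several producers on several grids). The number a material
box is scored by is the worst width of the best window available at each of its points,
`sup_{θ ∈ box} (min_k C_k(θ) − max_j F_j(θ))` over the words whose cells contain `θ` — so far an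
INSTRUMENT READING (a float branch-and-bound). This file makes it a KERNEL STATEMENT: a certificate is a
kd-tree over the box whose leaves name a pair (floor word `j`, cap word `k`); the leaf check verifies, in
exact rational arithmetic, that the leaf box lies in both cells and that `C_k − F_j ≤ w`, `F_j ≥ ℓ`,
`C_k ≤ r` at the EIGHT CORNERS of the leaf box; since `C_k − F_j`, `F_j`, `C_k` are coordinatewise affine,
corner bounds are bounds on the whole leaf box (the vertex property of multilinear functions —
interval analysis' exact range of a multilinear form on a box, Moore 1966 §3 / the multilinear
(McCormick-type) envelope fact that a coordinatewise-affine function attains its extrema over a box at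
vertices, Rockafellar 1970 Thm 32.2 applied one coordinate at a time). Everything is PROVED; no named
fact, no number, no physics.

* §1 MULTILINEAR FORMS: `ml3 d u s n` (real, 8 rational coefficients, monomial order
  `[1, u, s, n, us, un, sn, usn]` — the order of the tree's `_mlword_Icc` words with `u = θ 0`, `s = θ 1`,
  `n = θ 2`), `ml3Q` (exact rational evaluation), `mlEval d θ = ml3 d (θ 0) (θ 1) (θ 2)`, `mlEval_vec8`
  (private: `ml3_ratCast`, `ml3_sub`, `ml3_neg`).
* §2 THE VERTEX PROPERTY: `le_of_affine_ends` (an affine function of one variable on a segment is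
  bounded by its larger end value), `ml3_le_of_corners` / `ml3_ge_of_corners` (8 corner values bound a
  coordinatewise-affine form on a box).
* §3 WORD RECORDS AND THE LEAF CHECK: `WordRec` (`lo hi : Fin 3 → ℚ`, floor / cap coefficients
  `f c : Fin 8 → ℚ`), `WordRec.Holds e w` (the word's meaning for a real function `e`), `cornersLe`,
  `cornersGe` (Boolean corner checks on a `Box`), their soundness, and
  **`widthLeaf W w ℓ r B (j, k)`** = `isEmptyBox B ∨ (B ⊆ cell j ∧ B ⊆ cell k ∧ corners(C_k − F_j) ≤ w ∧
  corners(F_j) ≥ ℓ ∧ corners(C_k) ≤ r)` with `widthLeaf_sound`.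
* §4 BOX THEOREMS from an accepted tree `t.check (widthLeaf W w ℓ r) (boxOfFn lo hi) = true`
  (discharged by `decide +kernel`) and `∀ i, (W i).Holds e`: **`exists_pair_of_kdWidthCheck`** (every
  point of the delivered box lies in a named floor cell and a named cap cell whose forms bracket `e`
  within `w` and inside `[ℓ, r]`), **`exists_window_of_kdWidthCheck`** (`∃ F C, F ≤ e θ ≤ C ∧ C − F ≤ w`),
  **`mem_Icc_of_kdWidthCheck`** (`ℓ ≤ e θ ≤ r`, the box-wide constant window), and the scalar-letter
  form `exists_window₃_of_kdWidthCheck`; `kdCheck_split` (a tree too large for one kernel call is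
  checked child by child).
* §5 BRIDGING LETTERS for consumers: `mem_Icc_vec3_iff_cast` (the two spellings of a rational box in
  `Fin 3 → ℝ`), `vec3_mem_Icc_cast_iff`, `mlEval_vec8` (unfolding a literal coefficient vector),
  `WordRec.holds_of_forall₃` (a word stated in six scalar letters gives `Holds`).

How a certificate is produced (the compute lane, not this file): exact-rational branch and bound — at a
node box, among the pairs `(j, k)` of pool words whose cells contain the node, take the one minimising
the largest corner value of `C_k − F_j`; accept if `≤ w` (and the hull checks pass), else bisect the
longest edge; print the tree as a `KdCert (ι × ι)` term. Soundness holds whatever the cuts and pairs are.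

What is NOT here: how a word is produced; that the resulting `w` is optimal; anything about the Hubbard
model (the consumer instantiates `e θ = energyDensityTT' 1 (θ 1) (θ 0) (θ 2)`).

## Tree search (nearest existing declarations, reused not restated)

`KdCert.check / .sound`, `Box.mem / .ivl / .split` (`Literature.Analysis.ValidatedNumerics.BoxCover`);
`subBox`, `isEmptyBox`, `cellLeaf`, `boxOfFn`, `zeroExtend`, `mem_of_subBox`, `not_mem_of_isEmptyBox`,
`mem_boxOfFn_zeroExtend_iff`, `exists_mem_Icc_and_of_kdCheck` (`BoxCoverCertificate`, imported and used);
`BoxCovering.forall_of_forall_cells` (composition given the cover). Interval-EVALUATION leaf checks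
(`exprLeOn`, `BoxInfeasibility`) enclose general expressions with overestimation; the corner check here is
EXACT for multilinear forms, which is why no working precision appears. `lean search
'widthLeaf|cornersLe|ml3|WordRec|mlEval'`: no prior declaration.

## References

* R. E. Moore, *Interval Analysis*, Prentice-Hall 1966, §3 (range of rational functions on boxes;
  functions linear in each variable attain their range at endpoint combinations) and §4.4 (subdivision).
  [cite: Moore1966, §3, §4.4]
* R. T. Rockafellar, *Convex Analysis*, Princeton 1970, Thm 32.2 (extrema of affine functions over a
  polytope are attained at vertices — applied one coordinate at a time). [cite: Rockafellar1970, Thm 32.2]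
* A. Neumaier, *Complete search in continuous global optimization and constraint satisfaction*, Acta
  Numerica 13 (2004), §12 eq. (12.2)–(12.3) (branch and bound: sub-boxes whose union is the box; a bound
  per sub-box). [cite: Neumaier2004CompleteSearch, §12]
* L. Jaulin, M. Kieffer, O. Didrit, É. Walter, *Applied Interval Analysis*, Springer 2001, ch. 2–3
  (interval vectors / boxes; subpavings as binary trees). [cite: JaulinKiefferDidritWalter2001, ch. 2]
-/

namespace Literature.Computation.Certificates.BoxCovering

open Set
open Literature.Analysis.ValidatedNumerics (Box KdCert)
open Literature.Analysis.ValidatedNumerics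

/-! ### §1 Multilinear (coordinatewise-affine) forms with eight rational coefficients -/

/-- The real coordinatewise-affine form with rational coefficients `d`, monomial order
`[1, u, s, n, u·s, u·n, s·n, u·s·n]` (the order of the tree's `_mlword_Icc` words, `u = θ 0 = U/t`,
`s = θ 1 = t'/t`, `n = θ 2`). [cite: Moore1966, §3] -/
def ml3 (d : Fin 8 → ℚ) (u s n : ℝ) : ℝ :=
  ((d 0 : ℚ) : ℝ) + ((d 1 : ℚ) : ℝ) * u + ((d 2 : ℚ) : ℝ) * s + ((d 3 : ℚ) : ℝ) * n +
    ((d 4 : ℚ) : ℝ) * u * s + ((d 5 : ℚ) : ℝ) * u * n + ((d 6 : ℚ) : ℝ) * s * n +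
    ((d 7 : ℚ) : ℝ) * u * s * n

/-- The same form evaluated in exact rational arithmetic (what the kernel computes at corners).
[cite: Moore1966, §3] -/
def ml3Q (d : Fin 8 → ℚ) (u s n : ℚ) : ℚ :=
  d 0 + d 1 * u + d 2 * s + d 3 * n + d 4 * u * s + d 5 * u * n + d 6 * s * n + d 7 * u * s * n

/-- At a rational point the real form is the cast of the rational evaluation. [folklore] -/
private theorem ml3_ratCast (d : Fin 8 → ℚ) (u s n : ℚ) :
    ml3 d (u : ℝ) (s : ℝ) (n : ℝ) = ((ml3Q d u s n : ℚ) : ℝ) := by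
  simp only [ml3, ml3Q]
  push_cast
  ring

/-- The form as a function of a point `θ : Fin 3 → ℝ` (`θ = ![U/t, t'/t, n]`). [cite: Moore1966, §3] -/
def mlEval (d : Fin 8 → ℚ) (θ : Fin 3 → ℝ) : ℝ := ml3 d (θ 0) (θ 1) (θ 2)

/-- Unfolding `mlEval` on a literal coefficient vector: the exact spelling of the tree's `_mlword_Icc`
conclusions (used by consumers to bridge a landed word to `WordRec.Holds` syntactically): the natural
(power-form) evaluation of a multilinear polynomial. [cite: Moore1966, §3] -/
theorem mlEval_vec8 (c₀ c₁ c₂ c₃ c₄ c₅ c₆ c₇ : ℚ) (θ : Fin 3 → ℝ) :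
    mlEval ![c₀, c₁, c₂, c₃, c₄, c₅, c₆, c₇] θ =
      ((c₀ : ℚ) : ℝ) + ((c₁ : ℚ) : ℝ) * θ 0 + ((c₂ : ℚ) : ℝ) * θ 1 + ((c₃ : ℚ) : ℝ) * θ 2 +
        ((c₄ : ℚ) : ℝ) * θ 0 * θ 1 + ((c₅ : ℚ) : ℝ) * θ 0 * θ 2 + ((c₆ : ℚ) : ℝ) * θ 1 * θ 2 +
        ((c₇ : ℚ) : ℝ) * θ 0 * θ 1 * θ 2 := by
  rfl

/-- The form is linear in its coefficients: difference of coefficient vectors. [folklore] -/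
private theorem ml3_sub (c f : Fin 8 → ℚ) (u s n : ℝ) :
    ml3 (fun i => c i - f i) u s n = ml3 c u s n - ml3 f u s n := by
  simp only [ml3]
  push_cast
  ring

/-- Negated coefficients negate the form. [folklore] -/
private theorem ml3_neg (f : Fin 8 → ℚ) (u s n : ℝ) : ml3 (fun i => -f i) u s n = -ml3 f u s n := by
  simp only [ml3]
  push_cast
  ring

/-! ### §2 The vertex property of coordinatewise-affine forms -/

/-- **An affine function of one real variable on a segment is bounded by its end values.** If
`P x = A + B·x` for all `x`, `lo ≤ x ≤ hi`, `P lo ≤ w` and `P hi ≤ w`, then `P x ≤ w`.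
[cite: Rockafellar1970, Thm 32.2] -/
theorem le_of_affine_ends (P : ℝ → ℝ) (A B : ℝ) (hP : ∀ x, P x = A + B * x) {x lo hi w : ℝ}
    (h₁ : lo ≤ x) (h₂ : x ≤ hi) (hlo : P lo ≤ w) (hhi : P hi ≤ w) : P x ≤ w := by
  rw [hP] at hlo hhi ⊢
  rcases le_total 0 B with hB | hB
  · have : B * x ≤ B * hi := mul_le_mul_of_nonneg_left h₂ hB
    linarith
  · have : B * x ≤ B * lo := mul_le_mul_of_nonpos_left h₁ hB
    linarith

/-- **Eight corner values bound a coordinatewise-affine form on a box from above.** If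
`lo₀ ≤ u ≤ hi₀`, `lo₁ ≤ s ≤ hi₁`, `lo₂ ≤ n ≤ hi₂` and `ml3 d` is `≤ w` at the eight corners
`(lo₀|hi₀, lo₁|hi₁, lo₂|hi₂)`, then `ml3 d u s n ≤ w`. [cite: Moore1966, §3] -/
theorem ml3_le_of_corners (d : Fin 8 → ℚ) {u s n lo₀ hi₀ lo₁ hi₁ lo₂ hi₂ w : ℝ}
    (hu₁ : lo₀ ≤ u) (hu₂ : u ≤ hi₀) (hs₁ : lo₁ ≤ s) (hs₂ : s ≤ hi₁) (hn₁ : lo₂ ≤ n) (hn₂ : n ≤ hi₂)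
    (h000 : ml3 d lo₀ lo₁ lo₂ ≤ w) (h001 : ml3 d lo₀ lo₁ hi₂ ≤ w)
    (h010 : ml3 d lo₀ hi₁ lo₂ ≤ w) (h011 : ml3 d lo₀ hi₁ hi₂ ≤ w)
    (h100 : ml3 d hi₀ lo₁ lo₂ ≤ w) (h101 : ml3 d hi₀ lo₁ hi₂ ≤ w)
    (h110 : ml3 d hi₀ hi₁ lo₂ ≤ w) (h111 : ml3 d hi₀ hi₁ hi₂ ≤ w) : ml3 d u s n ≤ w := by
  -- affine in `n` at fixed `(a, b)`
  have hn : ∀ a b : ℝ, ml3 d a b lo₂ ≤ w → ml3 d a b hi₂ ≤ w → ml3 d a b n ≤ w := by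
    intro a b hl hh
    refine le_of_affine_ends (fun x => ml3 d a b x)
      (((d 0 : ℚ) : ℝ) + ((d 1 : ℚ) : ℝ) * a + ((d 2 : ℚ) : ℝ) * b + ((d 4 : ℚ) : ℝ) * a * b)
      (((d 3 : ℚ) : ℝ) + ((d 5 : ℚ) : ℝ) * a + ((d 6 : ℚ) : ℝ) * b + ((d 7 : ℚ) : ℝ) * a * b)
      (fun x => by simp only [ml3]; ring) hn₁ hn₂ hl hh
  -- affine in `s` at fixed `a`, for the values already reduced in `n`
  have hs : ∀ a : ℝ, ml3 d a lo₁ lo₂ ≤ w → ml3 d a lo₁ hi₂ ≤ w → ml3 d a hi₁ lo₂ ≤ w →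
      ml3 d a hi₁ hi₂ ≤ w → ml3 d a s n ≤ w := by
    intro a h00 h01 h10 h11
    refine le_of_affine_ends (fun x => ml3 d a x n)
      (((d 0 : ℚ) : ℝ) + ((d 1 : ℚ) : ℝ) * a + ((d 3 : ℚ) : ℝ) * n + ((d 5 : ℚ) : ℝ) * a * n)
      (((d 2 : ℚ) : ℝ) + ((d 4 : ℚ) : ℝ) * a + ((d 6 : ℚ) : ℝ) * n + ((d 7 : ℚ) : ℝ) * a * n)
      (fun x => by simp only [ml3]; ring) hs₁ hs₂ (hn a lo₁ h00 h01) (hn a hi₁ h10 h11)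
  -- affine in `u`
  exact le_of_affine_ends (fun x => ml3 d x s n)
    (((d 0 : ℚ) : ℝ) + ((d 2 : ℚ) : ℝ) * s + ((d 3 : ℚ) : ℝ) * n + ((d 6 : ℚ) : ℝ) * s * n)
    (((d 1 : ℚ) : ℝ) + ((d 4 : ℚ) : ℝ) * s + ((d 5 : ℚ) : ℝ) * n + ((d 7 : ℚ) : ℝ) * s * n)
    (fun x => by simp only [ml3]; ring) hu₁ hu₂ (hs lo₀ h000 h001 h010 h011)
    (hs hi₀ h100 h101 h110 h111)

/-- **Eight corner values bound a coordinatewise-affine form on a box from below.**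
[cite: Moore1966, §3] -/
theorem ml3_ge_of_corners (d : Fin 8 → ℚ) {u s n lo₀ hi₀ lo₁ hi₁ lo₂ hi₂ w : ℝ}
    (hu₁ : lo₀ ≤ u) (hu₂ : u ≤ hi₀) (hs₁ : lo₁ ≤ s) (hs₂ : s ≤ hi₁) (hn₁ : lo₂ ≤ n) (hn₂ : n ≤ hi₂)
    (h000 : w ≤ ml3 d lo₀ lo₁ lo₂) (h001 : w ≤ ml3 d lo₀ lo₁ hi₂)
    (h010 : w ≤ ml3 d lo₀ hi₁ lo₂) (h011 : w ≤ ml3 d lo₀ hi₁ hi₂)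
    (h100 : w ≤ ml3 d hi₀ lo₁ lo₂) (h101 : w ≤ ml3 d hi₀ lo₁ hi₂)
    (h110 : w ≤ ml3 d hi₀ hi₁ lo₂) (h111 : w ≤ ml3 d hi₀ hi₁ hi₂) : w ≤ ml3 d u s n := by
  have key := ml3_le_of_corners (fun i => -d i) (w := -w) hu₁ hu₂ hs₁ hs₂ hn₁ hn₂
    (by rw [ml3_neg]; linarith) (by rw [ml3_neg]; linarith) (by rw [ml3_neg]; linarith)
    (by rw [ml3_neg]; linarith) (by rw [ml3_neg]; linarith) (by rw [ml3_neg]; linarith)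
    (by rw [ml3_neg]; linarith) (by rw [ml3_neg]; linarith)
  rw [ml3_neg] at key
  linarith

/-! ### §3 Word records, corner checks and the width leaf -/

/-- A TWO-SIDED MULTILINEAR WORD RECORD: the cell `[lo, hi]` (corner vectors in the order
`(U/t, t'/t, n)`), the floor coefficients `f` and the cap coefficients `c` (monomial order of `ml3`).
[cite: Neumaier2004CompleteSearch, §12] -/
structure WordRec where
  /-- lower corner of the cell -/
  lo : Fin 3 → ℚ
  /-- upper corner of the cell -/
  hi : Fin 3 → ℚ
  /-- floor coefficients -/
  f : Fin 8 → ℚ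
  /-- cap coefficients -/
  c : Fin 8 → ℚ

/-- The MEANING of a word record for a real function `e` on `Fin 3 → ℝ`: at every point of the cell,
`floor(θ) ≤ e θ ≤ cap(θ)`. [cite: Neumaier2004CompleteSearch, §12] -/
def WordRec.Holds (e : (Fin 3 → ℝ) → ℝ) (w : WordRec) : Prop :=
  ∀ θ ∈ Set.Icc (fun k => ((w.lo k : ℚ) : ℝ)) (fun k => ((w.hi k : ℚ) : ℝ)),
    mlEval w.f θ ≤ e θ ∧ e θ ≤ mlEval w.c θ

/-- The eight corners `(u, s, n)` of the first three stored coordinates of a `Box`. [folklore] -/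
def corners3 (B : Box) : List (ℚ × ℚ × ℚ) :=
  [((B.ivl 0).1, (B.ivl 1).1, (B.ivl 2).1), ((B.ivl 0).1, (B.ivl 1).1, (B.ivl 2).2),
   ((B.ivl 0).1, (B.ivl 1).2, (B.ivl 2).1), ((B.ivl 0).1, (B.ivl 1).2, (B.ivl 2).2),
   ((B.ivl 0).2, (B.ivl 1).1, (B.ivl 2).1), ((B.ivl 0).2, (B.ivl 1).1, (B.ivl 2).2),
   ((B.ivl 0).2, (B.ivl 1).2, (B.ivl 2).1), ((B.ivl 0).2, (B.ivl 1).2, (B.ivl 2).2)]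

/-- Corner check, upper form: `ml3Q d ≤ w` at the eight corners of `B`. [cite: Moore1966, §3] -/
def cornersLe (d : Fin 8 → ℚ) (B : Box) (w : ℚ) : Bool :=
  (corners3 B).all fun p => decide (ml3Q d p.1 p.2.1 p.2.2 ≤ w)

/-- Corner check, lower form: `w ≤ ml3Q d` at the eight corners of `B`. [cite: Moore1966, §3] -/
def cornersGe (d : Fin 8 → ℚ) (B : Box) (w : ℚ) : Bool :=
  (corners3 B).all fun p => decide (w ≤ ml3Q d p.1 p.2.1 p.2.2)

/-- **Soundness of the upper corner check**: at every real point of the box the form is `≤ w`.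
[cite: Moore1966, §3] -/
theorem ml3_le_of_cornersLe {d : Fin 8 → ℚ} {B : Box} {w : ℚ} (h : cornersLe d B w = true)
    {x : ℕ → ℝ} (hx : B.mem x) : ml3 d (x 0) (x 1) (x 2) ≤ ((w : ℚ) : ℝ) := by
  simp only [cornersLe, corners3, List.all_cons, List.all_nil, Bool.and_true, Bool.and_eq_true,
    decide_eq_true_eq] at h
  obtain ⟨h000, h001, h010, h011, h100, h101, h110, h111⟩ := h
  have c : ∀ {a b c' : ℚ}, ml3Q d a b c' ≤ w → ml3 d (a : ℝ) (b : ℝ) (c' : ℝ) ≤ ((w : ℚ) : ℝ) :=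
    fun hq => by rw [ml3_ratCast]; exact_mod_cast hq
  exact ml3_le_of_corners d (hx 0).1 (hx 0).2 (hx 1).1 (hx 1).2 (hx 2).1 (hx 2).2
    (c h000) (c h001) (c h010) (c h011) (c h100) (c h101) (c h110) (c h111)

/-- **Soundness of the lower corner check**: at every real point of the box the form is `≥ w`.
[cite: Moore1966, §3] -/
theorem ml3_ge_of_cornersGe {d : Fin 8 → ℚ} {B : Box} {w : ℚ} (h : cornersGe d B w = true)
    {x : ℕ → ℝ} (hx : B.mem x) : ((w : ℚ) : ℝ) ≤ ml3 d (x 0) (x 1) (x 2) := by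
  simp only [cornersGe, corners3, List.all_cons, List.all_nil, Bool.and_true, Bool.and_eq_true,
    decide_eq_true_eq] at h
  obtain ⟨h000, h001, h010, h011, h100, h101, h110, h111⟩ := h
  have c : ∀ {a b c' : ℚ}, w ≤ ml3Q d a b c' → ((w : ℚ) : ℝ) ≤ ml3 d (a : ℝ) (b : ℝ) (c' : ℝ) :=
    fun hq => by rw [ml3_ratCast]; exact_mod_cast hq
  exact ml3_ge_of_corners d (hx 0).1 (hx 0).2 (hx 1).1 (hx 1).2 (hx 2).1 (hx 2).2
    (c h000) (c h001) (c h010) (c h011) (c h100) (c h101) (c h110) (c h111)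

/-- **The WIDTH LEAF CHECK.** Leaf datum `(j, k)` = (floor word, cap word). Accepted iff the leaf box
is empty, or: it lies in word `j`'s cell and in word `k`'s cell, `cap_k − floor_j ≤ w` at its eight
corners, `floor_j ≥ ℓ` at its corners and `cap_k ≤ r` at its corners.
[cite: Neumaier2004CompleteSearch, §12] -/
def widthLeaf {ι : Type} (W : ι → WordRec) (w ℓ r : ℚ) (B : Box) (jk : ι × ι) : Bool :=
  isEmptyBox B ||
    (subBox B (boxOfFn (W jk.1).lo (W jk.1).hi) && subBox B (boxOfFn (W jk.2).lo (W jk.2).hi) &&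
      cornersLe (fun i => (W jk.2).c i - (W jk.1).f i) B w &&
      cornersGe (W jk.1).f B ℓ && cornersLe (W jk.2).c B r)

/-- The stored coordinate intervals of `boxOfFn` (re-proved here; private upstream). [folklore] -/
private theorem ivl_boxOfFn' {d : ℕ} (lo hi : Fin d → ℚ) {i : ℕ} (h : i < d) :
    (boxOfFn lo hi).ivl i = (lo ⟨i, h⟩, hi ⟨i, h⟩) := by
  unfold Box.ivl boxOfFn
  have hl : i < (List.ofFn fun k : Fin d => (lo k, hi k)).length := by simpa using h
  rw [List.getD_eq_getElem?_getD, List.getElem?_eq_getElem hl, Option.getD_some, List.getElem_ofFn]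

/-- A point of `boxOfFn lo hi` (as an `ℕ`-indexed point), read in `Fin 3` letters, lies in the cell
`Set.Icc lo hi`. [folklore] -/
private theorem fin3_mem_Icc_of_mem_boxOfFn {lo hi : Fin 3 → ℚ} {x : ℕ → ℝ}
    (hx : (boxOfFn lo hi).mem x) :
    (fun k : Fin 3 => x k) ∈ Set.Icc (fun k => ((lo k : ℚ) : ℝ)) (fun k => ((hi k : ℚ) : ℝ)) := by
  refine ⟨fun k => ?_, fun k => ?_⟩
  · have h := hx k
    rw [ivl_boxOfFn' lo hi k.isLt] at h
    exact h.1
  · have h := hx k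
    rw [ivl_boxOfFn' lo hi k.isLt] at h
    exact h.2

/-- **Soundness of the width leaf.** At every real point `x` of an accepted leaf box, with
`θ = (x 0, x 1, x 2)`: `θ` lies in the cells of words `j` and `k`, and — given that the two words hold for
`e` — `floor_j θ ≤ e θ ≤ cap_k θ`, `cap_k θ − floor_j θ ≤ w`, `ℓ ≤ floor_j θ`, `cap_k θ ≤ r`.
[cite: Neumaier2004CompleteSearch, §12] -/
theorem widthLeaf_sound {ι : Type} (W : ι → WordRec) (e : (Fin 3 → ℝ) → ℝ)
    (hW : ∀ i, (W i).Holds e) (w ℓ r : ℚ) :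
    ∀ (B : Box) (jk : ι × ι), widthLeaf W w ℓ r B jk = true → ∀ x, B.mem x →
      (fun k : Fin 3 => x k) ∈ Set.Icc (fun k => (((W jk.1).lo k : ℚ) : ℝ))
          (fun k => (((W jk.1).hi k : ℚ) : ℝ)) ∧
      (fun k : Fin 3 => x k) ∈ Set.Icc (fun k => (((W jk.2).lo k : ℚ) : ℝ))
          (fun k => (((W jk.2).hi k : ℚ) : ℝ)) ∧
      mlEval (W jk.1).f (fun k : Fin 3 => x k) ≤ e (fun k : Fin 3 => x k) ∧
      e (fun k : Fin 3 => x k) ≤ mlEval (W jk.2).c (fun k : Fin 3 => x k) ∧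
      mlEval (W jk.2).c (fun k : Fin 3 => x k) - mlEval (W jk.1).f (fun k : Fin 3 => x k) ≤
        ((w : ℚ) : ℝ) ∧
      ((ℓ : ℚ) : ℝ) ≤ mlEval (W jk.1).f (fun k : Fin 3 => x k) ∧
      mlEval (W jk.2).c (fun k : Fin 3 => x k) ≤ ((r : ℚ) : ℝ) := by
  intro B jk h x hx
  rw [widthLeaf, Bool.or_eq_true] at h
  rcases h with h | h
  · exact absurd hx (not_mem_of_isEmptyBox h x)
  simp only [Bool.and_eq_true] at h
  obtain ⟨⟨⟨⟨hj, hk⟩, hw⟩, hℓ⟩, hr⟩ := h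
  have hθj := fin3_mem_Icc_of_mem_boxOfFn (mem_of_subBox hj hx)
  have hθk := fin3_mem_Icc_of_mem_boxOfFn (mem_of_subBox hk hx)
  have hfl := (hW jk.1 _ hθj).1
  have hcap := (hW jk.2 _ hθk).2
  have hw' := ml3_le_of_cornersLe hw hx
  rw [ml3_sub] at hw'
  have hℓ' := ml3_ge_of_cornersGe hℓ hx
  have hr' := ml3_le_of_cornersLe hr hx
  exact ⟨hθj, hθk, hfl, hcap, hw', hℓ', hr'⟩

/-! ### §4 Box theorems from an accepted width certificate -/

/-- **Every point of the delivered box is bracketed by a named pair within `w` and inside `[ℓ, r]`.**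
Words `W : ι → WordRec` all holding for `e`, a delivered box `[lo, hi]` (rational corner vectors) and an
accepted certificate `t.check (widthLeaf W w ℓ r) (boxOfFn lo hi) = true` (by `decide +kernel`): then
for every real `θ ∈ [lo, hi]` there are words `j`, `k` whose cells contain `θ` with
`floor_j θ ≤ e θ ≤ cap_k θ`, `cap_k θ − floor_j θ ≤ w`, `ℓ ≤ floor_j θ` and `cap_k θ ≤ r`.
[cite: Neumaier2004CompleteSearch, §12] -/
theorem exists_pair_of_kdWidthCheck {ι : Type} (W : ι → WordRec) (e : (Fin 3 → ℝ) → ℝ)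
    (hW : ∀ i, (W i).Holds e) {w ℓ r : ℚ} {lo hi : Fin 3 → ℚ} {t : KdCert (ι × ι)}
    (h : t.check (widthLeaf W w ℓ r) (boxOfFn lo hi) = true) :
    ∀ θ ∈ Set.Icc (fun k => ((lo k : ℚ) : ℝ)) (fun k => ((hi k : ℚ) : ℝ)),
      ∃ j k : ι,
        θ ∈ Set.Icc (fun k => (((W j).lo k : ℚ) : ℝ)) (fun k => (((W j).hi k : ℚ) : ℝ)) ∧
        θ ∈ Set.Icc (fun i => (((W k).lo i : ℚ) : ℝ)) (fun i => (((W k).hi i : ℚ) : ℝ)) ∧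
        mlEval (W j).f θ ≤ e θ ∧ e θ ≤ mlEval (W k).c θ ∧
        mlEval (W k).c θ - mlEval (W j).f θ ≤ ((w : ℚ) : ℝ) ∧
        ((ℓ : ℚ) : ℝ) ≤ mlEval (W j).f θ ∧ mlEval (W k).c θ ≤ ((r : ℚ) : ℝ) := by
  intro θ hθ
  have hx : (boxOfFn lo hi).mem (zeroExtend θ) := (mem_boxOfFn_zeroExtend_iff lo hi θ).2 hθ
  have key := KdCert.sound
    (P := fun x => ∃ j k : ι,
        (fun k : Fin 3 => x k) ∈ Set.Icc (fun k => (((W j).lo k : ℚ) : ℝ))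
            (fun k => (((W j).hi k : ℚ) : ℝ)) ∧
        (fun i : Fin 3 => x i) ∈ Set.Icc (fun i => (((W k).lo i : ℚ) : ℝ))
            (fun i => (((W k).hi i : ℚ) : ℝ)) ∧
        mlEval (W j).f (fun k : Fin 3 => x k) ≤ e (fun k : Fin 3 => x k) ∧
        e (fun k : Fin 3 => x k) ≤ mlEval (W k).c (fun k : Fin 3 => x k) ∧
        mlEval (W k).c (fun k : Fin 3 => x k) - mlEval (W j).f (fun k : Fin 3 => x k) ≤
          ((w : ℚ) : ℝ) ∧
        ((ℓ : ℚ) : ℝ) ≤ mlEval (W j).f (fun k : Fin 3 => x k) ∧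
        mlEval (W k).c (fun k : Fin 3 => x k) ≤ ((r : ℚ) : ℝ))
    (fun B jk hB x hx => ⟨jk.1, jk.2, widthLeaf_sound W e hW w ℓ r B jk hB x hx⟩) t _ h _ hx
  have hθx : (fun k : Fin 3 => zeroExtend θ (k : ℕ)) = θ := by
    funext k
    simp [zeroExtend, k.isLt]
  rw [hθx] at key
  exact key

/-- **Box-wide TILED WIDTH.** Under the hypotheses of `exists_pair_of_kdWidthCheck`: at every point of the
delivered box the function `e` has a certified window of width at most `w`.
[cite: Neumaier2004CompleteSearch, §12] -/
theorem exists_window_of_kdWidthCheck {ι : Type} (W : ι → WordRec) (e : (Fin 3 → ℝ) → ℝ)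
    (hW : ∀ i, (W i).Holds e) {w ℓ r : ℚ} {lo hi : Fin 3 → ℚ} {t : KdCert (ι × ι)}
    (h : t.check (widthLeaf W w ℓ r) (boxOfFn lo hi) = true) :
    ∀ θ ∈ Set.Icc (fun k => ((lo k : ℚ) : ℝ)) (fun k => ((hi k : ℚ) : ℝ)),
      ∃ F C : ℝ, F ≤ e θ ∧ e θ ≤ C ∧ C - F ≤ ((w : ℚ) : ℝ) := by
  intro θ hθ
  obtain ⟨j, k, -, -, hF, hC, hw, -, -⟩ := exists_pair_of_kdWidthCheck W e hW h θ hθ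
  exact ⟨_, _, hF, hC, hw⟩

/-- **Box-wide HULL WINDOW.** Under the hypotheses of `exists_pair_of_kdWidthCheck`: at every point of
the delivered box `ℓ ≤ e θ ≤ r`. [cite: Neumaier2004CompleteSearch, §12] -/
theorem mem_Icc_of_kdWidthCheck {ι : Type} (W : ι → WordRec) (e : (Fin 3 → ℝ) → ℝ)
    (hW : ∀ i, (W i).Holds e) {w ℓ r : ℚ} {lo hi : Fin 3 → ℚ} {t : KdCert (ι × ι)}
    (h : t.check (widthLeaf W w ℓ r) (boxOfFn lo hi) = true) :
    ∀ θ ∈ Set.Icc (fun k => ((lo k : ℚ) : ℝ)) (fun k => ((hi k : ℚ) : ℝ)),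
      ((ℓ : ℚ) : ℝ) ≤ e θ ∧ e θ ≤ ((r : ℚ) : ℝ) := by
  intro θ hθ
  obtain ⟨j, k, -, -, hF, hC, -, hℓ, hr⟩ := exists_pair_of_kdWidthCheck W e hW h θ hθ
  exact ⟨hℓ.trans hF, hC.trans hr⟩

/-- **Assembling a certificate from checked sub-trees** (for trees too large for one kernel call): if
the two children are accepted on the two halves of `B`, the split node is accepted on `B` (branching step of a
branch-and-bound certificate: the sub-boxes' checks make the box's check). [cite: Neumaier2004CompleteSearch, §12] -/
theorem kdCheck_split {α : Type} {leafOK : Box → α → Bool} {B : Box} {axis : ℕ} {cut : ℚ}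
    {t₁ t₂ : KdCert α} (h₁ : t₁.check leafOK (B.split axis cut).1 = true)
    (h₂ : t₂.check leafOK (B.split axis cut).2 = true) :
    (KdCert.split axis cut t₁ t₂).check leafOK B = true := by
  simp [KdCert.check, h₁, h₂]

/-! ### §5 Bridging letters for consumers -/

/-- A triple of reals as a point of `Fin 3 → ℝ` lies in the rational box (an interval vector) iff the six
scalar inequalities hold. [cite: JaulinKiefferDidritWalter2001, ch. 2] -/
theorem vec3_mem_Icc_cast_iff (a b : Fin 3 → ℚ) (u s n : ℝ) :
    (![u, s, n] : Fin 3 → ℝ) ∈ Set.Icc (fun k => ((a k : ℚ) : ℝ)) (fun k => ((b k : ℚ) : ℝ)) ↔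
      ((a 0 : ℚ) : ℝ) ≤ u ∧ u ≤ ((b 0 : ℚ) : ℝ) ∧ ((a 1 : ℚ) : ℝ) ≤ s ∧ s ≤ ((b 1 : ℚ) : ℝ) ∧
        ((a 2 : ℚ) : ℝ) ≤ n ∧ n ≤ ((b 2 : ℚ) : ℝ) := by
  simp only [Set.mem_Icc, Pi.le_def, Fin.forall_fin_succ, Matrix.cons_val_zero,
    Matrix.cons_val_succ]
  constructor
  · rintro ⟨⟨h₁, h₂, h₃, -⟩, h₄, h₅, h₆, -⟩
    exact ⟨h₁, h₄, h₂, h₅, h₃, h₆⟩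
  · rintro ⟨h₁, h₄, h₂, h₅, h₃, h₆⟩
    exact ⟨⟨h₁, h₂, h₃, fun i => Fin.elim0 i⟩, h₄, h₅, h₆, fun i => Fin.elim0 i⟩

/-- **The two spellings of a rational box agree**: membership in `Set.Icc` with corner FUNCTIONS
`fun k => ((lo k : ℚ) : ℝ)` (the certificate's spelling) iff membership with the literal real corner
VECTORS `![((lo 0 : ℚ) : ℝ), …]` (the spelling of the tree's `_mlword_Icc` words, after `push_cast`) — a
point lies in an interval vector iff each coordinate lies in its interval.
[cite: JaulinKiefferDidritWalter2001, ch. 2] -/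
theorem mem_Icc_vec3_iff_cast (lo hi : Fin 3 → ℚ) (θ : Fin 3 → ℝ) :
    θ ∈ Set.Icc (fun k => ((lo k : ℚ) : ℝ)) (fun k => ((hi k : ℚ) : ℝ)) ↔
      θ ∈ Set.Icc (![((lo 0 : ℚ) : ℝ), ((lo 1 : ℚ) : ℝ), ((lo 2 : ℚ) : ℝ)] : Fin 3 → ℝ)
        ![((hi 0 : ℚ) : ℝ), ((hi 1 : ℚ) : ℝ), ((hi 2 : ℚ) : ℝ)] := by
  have hθ : θ = ![θ 0, θ 1, θ 2] := by
    funext k; fin_cases k <;> rfl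
  rw [hθ, vec3_mem_Icc_cast_iff]
  simp only [Set.mem_Icc, Pi.le_def, Fin.forall_fin_succ, Matrix.cons_val_zero,
    Matrix.cons_val_succ, Matrix.cons_val_fin_one, IsEmpty.forall_iff, and_true]
  tauto

/-- **Scalar form ⇒ record.** A word stated as six scalar hypotheses on `u = θ 0`, `s = θ 1`, `n = θ 2`
(coordinatewise membership in the interval vector) gives `WordRec.Holds`.
[cite: JaulinKiefferDidritWalter2001, ch. 2] -/
theorem WordRec.holds_of_forall₃ (e : (Fin 3 → ℝ) → ℝ) (wr : WordRec)
    (h : ∀ θ : Fin 3 → ℝ, ((wr.lo 0 : ℚ) : ℝ) ≤ θ 0 → θ 0 ≤ ((wr.hi 0 : ℚ) : ℝ) →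
      ((wr.lo 1 : ℚ) : ℝ) ≤ θ 1 → θ 1 ≤ ((wr.hi 1 : ℚ) : ℝ) →
      ((wr.lo 2 : ℚ) : ℝ) ≤ θ 2 → θ 2 ≤ ((wr.hi 2 : ℚ) : ℝ) →
      mlEval wr.f θ ≤ e θ ∧ e θ ≤ mlEval wr.c θ) : wr.Holds e := by
  intro θ hθ
  exact h θ (hθ.1 0) (hθ.2 0) (hθ.1 1) (hθ.2 1) (hθ.1 2) (hθ.2 2)

/-- **Scalar letters of the width theorem** (`(U/t, t'/t, n)` order): every `(u, s, n)` of the delivered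
box has a certified window of width `≤ w` and lies in the hull window `[ℓ, r]`.
[cite: Neumaier2004CompleteSearch, §12] -/
theorem exists_window₃_of_kdWidthCheck {ι : Type} (W : ι → WordRec) (e : (Fin 3 → ℝ) → ℝ)
    (hW : ∀ i, (W i).Holds e) {w ℓ r : ℚ} {lo hi : Fin 3 → ℚ} {t : KdCert (ι × ι)}
    (h : t.check (widthLeaf W w ℓ r) (boxOfFn lo hi) = true) {u s n : ℝ}
    (hu₁ : ((lo 0 : ℚ) : ℝ) ≤ u) (hu₂ : u ≤ ((hi 0 : ℚ) : ℝ))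
    (hs₁ : ((lo 1 : ℚ) : ℝ) ≤ s) (hs₂ : s ≤ ((hi 1 : ℚ) : ℝ))
    (hn₁ : ((lo 2 : ℚ) : ℝ) ≤ n) (hn₂ : n ≤ ((hi 2 : ℚ) : ℝ)) :
    (∃ F C : ℝ, F ≤ e ![u, s, n] ∧ e ![u, s, n] ≤ C ∧ C - F ≤ ((w : ℚ) : ℝ)) ∧
      ((ℓ : ℚ) : ℝ) ≤ e ![u, s, n] ∧ e ![u, s, n] ≤ ((r : ℚ) : ℝ) := by
  have hθ : (![u, s, n] : Fin 3 → ℝ) ∈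
      Set.Icc (fun k => ((lo k : ℚ) : ℝ)) (fun k => ((hi k : ℚ) : ℝ)) :=
    (vec3_mem_Icc_cast_iff lo hi u s n).2 ⟨hu₁, hu₂, hs₁, hs₂, hn₁, hn₂⟩
  exact ⟨exists_window_of_kdWidthCheck W e hW h _ hθ, mem_Icc_of_kdWidthCheck W e hW h _ hθ⟩

/-- Kernel example (3 coordinates, two words on the cells `[0,1]×[0,1]×[0,1]` and `[1,2]×[0,1]×[0,1]`
with floors `θ₀` resp. `1` and caps `θ₀ + 1/2` resp. `2`): the tree cutting `θ₀` at `1` with leaves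
`(0,0)` and `(1,1)` certifies width `1`, hull `[0, 2]` on `[0,2]×[0,1]×[0,1]`; a tree claiming width
`1/2` on the second cell is rejected. -/
example :
    (KdCert.split 0 1 (.leaf ((0 : Fin 2), (0 : Fin 2))) (.leaf (1, 1))).check
        (widthLeaf (![⟨![0, 0, 0], ![1, 1, 1], ![0, 1, 0, 0, 0, 0, 0, 0], ![1/2, 1, 0, 0, 0, 0, 0, 0]⟩,
          ⟨![1, 0, 0], ![2, 1, 1], ![1, 0, 0, 0, 0, 0, 0, 0], ![2, 0, 0, 0, 0, 0, 0, 0]⟩] :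
            Fin 2 → WordRec) 1 0 2)
        (boxOfFn (![0, 0, 0] : Fin 3 → ℚ) ![2, 1, 1]) = true ∧
    (KdCert.split 0 1 (.leaf ((0 : Fin 2), (0 : Fin 2))) (.leaf (1, 1))).check
        (widthLeaf (![⟨![0, 0, 0], ![1, 1, 1], ![0, 1, 0, 0, 0, 0, 0, 0], ![1/2, 1, 0, 0, 0, 0, 0, 0]⟩,
          ⟨![1, 0, 0], ![2, 1, 1], ![1, 0, 0, 0, 0, 0, 0, 0], ![2, 0, 0, 0, 0, 0, 0, 0]⟩] :
            Fin 2 → WordRec) (1/2) 0 2)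
        (boxOfFn (![0, 0, 0] : Fin 3 → ℚ) ![2, 1, 1]) = false := by
  constructor <;> decide +kernel

end Literature.Computation.Certificates.BoxCovering
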